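import Literature.AnabelianGeometry.EtaleTheta.Discharge.Sec4NonVacuityNoRootsL01a
import Literature.AnabelianGeometry.EtaleTheta.Discharge.Sec4Remark411
import Literature.AlgebraicGeometry.Frobenioids.ModelFrobenioidPullbacks
import HarnessLib

/-!
# [EtTh] Remark 4.1.1 (categorical quotient) HOLDS at the cover-free toy — a (degenerate) positive instance
# of the typed `BiKummerSetting.Remark411` (consistency witness)

S. Mochizuki, *The étale theta function and its Frobenioid-theoretic manifestations*, Publ. RIMS **45**
(2009) [MochizukiEtTh2009], §4, Remark 4.1.1 p.88 (PDF): "if `α : A → B` is of base-Frobenius type, then …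
`A → B` is a categorical quotient [cf. [FrdI], §0] of `A` by the subgroup `G · μ_N(A) ⊆ Aut_C(A)` in the full
subcategory of `C` determined by the Frobenius-trivial objects".

CONSISTENCY WITNESS, TOY.  The typed `Remark411` (abc-iut-L2-t3, `BiKummer.lean`) is NOT valid over arbitrary
settings (abc-iut-f-108: universal closure refuted over a span-shaped base, F-0729; its first clause holds at every
canonical model with `Φ` divisorial, `remark411_actsOver`).  This PROOF-ONLY file gives a first POSITIVE kernel
instance: at the cover-free, constant-free toy `Toy.biKummerSetting` (p418516) the typed Remark 4.1.1 HOLDS —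
degenerately: since no object there is `μ_N`-saturated for `N ≥ 2` (`Toy.not_isMuSaturated`, p430171), condition
(a) of Def 4.1 (iv) forces every morphism `α` of base-Frobenius type to have Frobenius degree `1`; then `α =
α'' ≫ α'` with `α'` a pull-back morphism (degree `1`, `Div = 0`) and `α''` of Frobenius type (`Div = 0`), so `α` is an
isometry of degree `1` over an (automatic) base-isomorphism, hence an ISOMORPHISM (L1's `ModelFrobenioid.isIso_of`),
and an isomorphism is trivially a categorical quotient.

* `Toy.degFr_eq_one_of_baseFrobeniusTypeData`, `Toy.isIso_of_baseFrobeniusTypeData`;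
* `Toy.remark411 : Toy.biKummerSetting.Remark411`.

So the typed Remark 4.1.1 is consistent with the setting axioms (it has a model), while f-108's schema certificate
shows it is not a consequence of them; at the Kummer-tower toys `ToyCov`/`ToyCovZ` (where `μ_N`-saturation is real
and degree-`N` data exist) the quotient clause fails for the same reason as over f-108's span base (`Aut_D(∗) = 1`
cannot see the cover).  Degenerate instance; consistency ≠ faithfulness; typed ≠ proved.  Nothing here bears on, or
takes a side on, [IUTchIII] Cor. 3.12.
-/

noncomputable section

namespace Literature.AnabelianGeometry.EtaleTheta

open CategoryTheory Opposite Literature.AlgebraicGeometry.Frobenioids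
open scoped NNRat

namespace Toy

/-- **At the cover-free toy every morphism of base-Frobenius type has Frobenius degree `1`**: Def 4.1 (iv)(a)
asks `A` to be `μ_N`-saturated with `N = deg_Fr(α)`, and no object of the toy is `μ_N`-saturated for `N ≥ 2`.
[cite: MochizukiEtTh2009, Def 4.1 p.87] -/
theorem degFr_eq_one_of_baseFrobeniusTypeData {A B : biKummerSetting.C} {α : A ⟶ B}
    (d : biKummerSetting.BaseFrobeniusTypeData α) : biKummerSetting.degFr α = 1 := by
  by_contra hne
  have hne' : ((biKummerSetting.degFr α : ℕ+) : ℕ) ≠ 1 := fun h => hne (PNat.coe_eq_one_iff.mp h)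
  have hpos : 0 < ((biKummerSetting.degFr α : ℕ+) : ℕ) := PNat.pos _
  exact not_isMuSaturated A (N := biKummerSetting.degFr α) (by omega) d.isMuSaturated

/-- **… hence is an isomorphism**: `α = α'' ≫ α'` with `Div(α') = Div(α'') = 0` (pull-back morphism; Frobenius
type) and total degree `1`, over the one-object base where every base morphism is invertible — so L1's
`ModelFrobenioid.isIso_of` ([FrdI] Thm 5.2 (ii)) applies. [cite: MochizukiEtTh2009, Def 4.1 p.87] -/
theorem isIso_of_baseFrobeniusTypeData {A B : biKummerSetting.C} {α : A ⟶ B}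
    (d : biKummerSetting.BaseFrobeniusTypeData α) : IsIso α := by
  have hN : ModelFrobenioid.degFr α = 1 := degFr_eq_one_of_baseFrobeniusTypeData d
  obtain ⟨-, h1d⟩ := ModelFrobenioid.degFr_div_of_isPullbackMorphism divisorMonoidQ_isDivisorial d.cond_d
  have h2d : ModelFrobenioid.div d.α₂ = 1 := d.cond_c.2.1.2
  have hdiv : ModelFrobenioid.div α = 1 := by
    rw [← d.fac, ModelFrobenioid.div_comp, h1d, h2d, one_pow, mul_one]
    exact map_one _
  exact ModelFrobenioid.isIso_of ratFnFunctorQ_isGroupLike α hdiv hN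

/-- **[EtTh] Remark 4.1.1 HOLDS at the cover-free toy setting** (typed `BiKummerSetting.Remark411`, both clauses):
the action clause by abc-iut-w4-d044's `remark411_actsOver` (`Φ` divisorial), the categorical-quotient clause
because every `α` of base-Frobenius type is an isomorphism there (`ψ' := α⁻¹ ≫ ψ`, unique by cancellation).  A
degenerate but genuine model of the typed statement, complementing abc-iut-f-108's refutation of its universal
closure. [cite: MochizukiEtTh2009, Rmk 4.1.1 p.88] -/
theorem remark411 : biKummerSetting.Remark411 := by
  intro A B α d
  refine ⟨biKummerSetting.remark411_actsOver divisorMonoidQ_isDivisorial α d, fun X _ ψ _ => ?_⟩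
  haveI : IsIso α := isIso_of_baseFrobeniusTypeData d
  refine ⟨inv α ≫ ψ, by simp, fun ψ' hψ' => ?_⟩
  rw [← hψ', IsIso.inv_hom_id_assoc]

end Toy

end Literature.AnabelianGeometry.EtaleTheta

end
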